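import Mathlib
import HarnessLib
import Literature.Probability.MarkovChains.PeskunOrdering
import Literature.Probability.MarkovChains.IndependenceSamplerSpectralGap

/-!
# The Metropolized independence sampler never beats self-normalised importance sampling:
# `v(f, p, P_IMH) ≥ 2 Σ p f̄²/ρ − Σ p f̄² ≥ Σ_x p_x w_x f̄_x²` (Deligiannidis–Lee 2018, Prop. 3 of §3.2; finite state space)

HONEST FRAMING: exact (Metropolis-corrected) sampling algorithms for lattice gauge theory; figures
of merit are autocorrelation/cost numbers at stated couplings and volumes; no continuum-physics claim.

Sources.  G. Deligiannidis and A. Lee, *Which ergodic averages have finite asymptotic variance?*,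
Ann. Appl. Probab. 28 (2018) 2309–2334 [DeligiannidisLee2018], §3.2 "Comparison with self-normalized
importance sampling", the Proposition there: for the independent Metropolis–Hastings chain `P` with
target `π`, proposal `μ`, `w = dπ/dμ` and per-state acceptance `ϱ(x) = ∫ 1 ∧ (w(y)/w(x)) μ(dy)`,
"`2π(ϱ)π̃(f²/ϱ²) − π(f²) ≤ var(f, P)` … and `var(f, P) ≥ π(w·f²)`", the right side of the last
inequality being the limiting variance of the self-normalised importance sampling estimator
`Σ w(Zᵢ) f(Zᵢ)/Σ w(Zᵢ)`, `Zᵢ ∼ μ` i.i.d. ("the former is always larger than the latter"); the proof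
there rests on the POSITIVITY of the jump chain (A. Doucet, M. K. Pitt, G. Deligiannidis, R. Kohn,
Biometrika 102 (2015), Prop. 3) and a variational formula.  J. S. Liu, *Metropolized independent
sampling …*, Statistics and Computing 6 (1996) [Liu1996IMH], §2 supplies the finite-state
eigen-structure used by the sibling file `IndependenceSamplerSpectrum.lean`.

This file proves the FINITE-STATE form with Kemeny–Snell's asymptotic variance
`asympVar f π P` and the Bellman / Caracciolo–Pelissetto–Sokal variational inequality of
`PeskunOrdering.lean` (`variational_le`).  Everything is PROVED (0 named facts).  Setting: finite `X`,
target `p > 0` with `Σ p = 1`, proposal law `q > 0` with `Σ q = 1`, IMH matrix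
`A = mhKernel (fun _ z => q z) p`, weight `w = p/q`, per-state acceptance
`ρ x = Σ_y mhRate (fun _ z => q z) p x y` (`= Σ_y q_y (1 ∧ w_y/w_x)`, `= 1 − λ_x` with Liu's
eigenvalue `λ_x = imhEigenvalue q p x`).

* `sum_sum_mul_min_nonneg` — the `min` kernel is positive semidefinite:
  `0 ≤ Σ_x Σ_y a_x a_y min(c_x, c_y)` for `c ≥ 0` (layer cake: `min(c, c') = ∫₀^∞ 1[u<c]1[u<c'] du`);
  [folklore]
* `imh_mul_mhRate_eq`, `imh_jump_nonneg` — `p_x · mhRate x y = q_x q_y min(w_x, w_y)` and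
  `0 ≤ Σ_x Σ_y p_x · mhRate x y · u_x u_y`: the accepted-jump part of `A` is a positive kernel
  [cite: DeligiannidisLee2018, §3.2 proof of the Proposition ("`P̃` is a positive operator")];
* `imh_dirichletForm_le` — `𝓔_A(u) ≤ Σ_x p_x ρ_x u_x²` [cite: DeligiannidisLee2018, §3.2];
* `imh_accept_bounds` — `0 < ρ_x ≤ 1`, `ρ_x ≤ q_x/p_x = 1/w_x`; `inv_add_ge_tangent` (tangent line of
  `t ↦ 1/(a+t)`) [folklore]; **`imh_accept_ge_inv`** — `ρ_x ≥ 1/(Σ_y p_y w_y + w_x)`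
  [cite: DeligiannidisLee2018, §3.1 Corollary 2 (cor:imh_rho_bounds)
  ("for the IMH, `1/(π(w) + w(x)) ≤ ϱ(x) ≤ 1 ∧ 1/w(x)`")];
* **`imh_asympVar_ge_accept`** — for centred `f` (`Σ p f = 0`):
  `asympVar f p A ≥ 2 Σ_x p_x f_x²/ρ_x − Σ_x p_x f_x²`
  [cite: DeligiannidisLee2018, §3.2 Proposition, first inequality];
* **`imh_asympVar_ge_importanceSampling`** — for every `f`, with `f̄ = f − Σ p f`:
  `asympVar f p A ≥ Σ_x p_x (p_x/q_x) f̄_x²` [cite: DeligiannidisLee2018, §3.2 Proposition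
  ("`var(f,P) ≥ π(w·f²)`")]; `imh_asympVar_ge_var` — `asympVar f p A ≥ Σ p f̄²` (positivity).
-/

namespace Literature.Probability.MarkovChains

open Finset Matrix
open scoped BigOperators

variable {X : Type*} [Fintype X] [DecidableEq X] {p q : X → ℝ}

omit [DecidableEq X] in
/-- **The `min` kernel is positive semidefinite**: `0 ≤ Σ_x Σ_y a_x a_y min(c_x, c_y)` whenever
`c ≥ 0` (layer cake `min(c, c') = ∫ 1_{(0,c)} 1_{(0,c')}`, so the double sum is
`∫ (Σ_x a_x 1_{(0,c_x)})² ≥ 0`). [folklore] -/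
private theorem sum_sum_mul_min_nonneg (a c : X → ℝ) (hc : ∀ x, 0 ≤ c x) :
    0 ≤ ∑ x, ∑ y, a x * a y * min (c x) (c y) := by
  -- indicator of `(0, c_x)` on the real line
  set F : X → ℝ → ℝ := fun x => (Set.Ioo 0 (c x)).indicator fun _ => (1:ℝ) with hF
  have hFm : ∀ x, Measurable (F x) := fun x =>
    (measurable_const.indicator measurableSet_Ioo)
  have hF01 : ∀ x u, 0 ≤ F x u ∧ F x u ≤ 1 := fun x u => by
    simp only [hF, Set.indicator]; split_ifs <;> norm_num
  -- layer cake: `∫ F_x F_y = min(c_x, c_y)`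
  have hprod : ∀ x y, (fun u => F x u * F y u) = (Set.Ioo 0 (min (c x) (c y))).indicator fun _ => (1:ℝ) := by
    intro x y; funext u
    simp only [hF, Set.indicator, Set.mem_Ioo, lt_min_iff]
    split_ifs <;> first | rfl | (exfalso; tauto) | simp_all
  have hlayer : ∀ x y, ∫ u, F x u * F y u = min (c x) (c y) := by
    intro x y
    rw [hprod x y, MeasureTheory.integral_indicator measurableSet_Ioo, MeasureTheory.setIntegral_const,
      MeasureTheory.measureReal_def, Real.volume_Ioo, sub_zero,
      ENNReal.toReal_ofReal (le_min (hc x) (hc y)), smul_eq_mul, mul_one]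
  have hint : ∀ x y, MeasureTheory.Integrable (fun u => a x * a y * (F x u * F y u)) := by
    intro x y
    have h1 : MeasureTheory.Integrable (fun u => F x u * F y u) := by
      rw [hprod x y]
      exact (MeasureTheory.integrable_indicator_iff measurableSet_Ioo).2
        (MeasureTheory.integrableOn_const (by rw [Real.volume_Ioo]; exact ENNReal.ofReal_ne_top))
    exact h1.const_mul _
  have hterm : ∀ x y, a x * a y * min (c x) (c y) = ∫ u, a x * a y * (F x u * F y u) := by
    intro x y
    rw [MeasureTheory.integral_const_mul, hlayer x y]
  simp_rw [hterm]
  have hinner : ∀ x, MeasureTheory.Integrable (fun u => ∑ y, a x * a y * (F x u * F y u)) := fun x =>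
    MeasureTheory.integrable_finsetSum _ fun y _ => hint x y
  rw [show (∑ x, ∑ y, ∫ u, a x * a y * (F x u * F y u))
      = ∫ u, ∑ x, ∑ y, a x * a y * (F x u * F y u) by
    rw [MeasureTheory.integral_finsetSum _ fun x _ => hinner x]
    exact Finset.sum_congr rfl fun x _ => (MeasureTheory.integral_finsetSum _ fun y _ => hint x y).symm]
  refine MeasureTheory.integral_nonneg fun u => ?_
  have e : ∑ x, ∑ y, a x * a y * (F x u * F y u) = (∑ x, a x * F x u) ^ 2 := by
    rw [sq, Finset.sum_mul_sum]
    refine Finset.sum_congr rfl fun x _ => Finset.sum_congr rfl fun y _ => by ring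
  show 0 ≤ ∑ x, ∑ y, a x * a y * (F x u * F y u)
  rw [e]; exact sq_nonneg _

omit [Fintype X] [DecidableEq X] in
/-- Reweighting the rate: `p_x · mhRate x y = q_x q_y · min(w_x, w_y)` for the independence proposal
`T x y = q y`, `w = p/q` (`p, q > 0`). [cite: DeligiannidisLee2018, §3.1 proof of Lemma
(lem:imh_uniform_minor) ("`μ(dy)[1 ∧ w(y)/w(x)] = π(dy)[1/w(y) ∧ 1/w(x)]`")] -/
theorem imh_mul_mhRate_eq (hp : ∀ x, 0 < p x) (hq : ∀ x, 0 < q x) (x y : X) :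
    p x * mhRate (fun _ z => q z) p x y = q x * q y * min (p x / q x) (p y / q y) := by
  rw [mul_mhRate hp]
  have hqx := hq x
  have hqy := hq y
  rw [show p x * q y = q x * q y * (p x / q x) by field_simp,
    show p y * q x = q x * q y * (p y / q y) by field_simp]
  exact ((monotone_mul_left_of_nonneg (mul_pos hqx hqy).le).map_min).symm

omit [DecidableEq X] in
/-- **The accepted-jump kernel of the independence sampler is positive semidefinite**:
`0 ≤ Σ_x Σ_y p_x · mhRate x y · u_x u_y`. [cite: DeligiannidisLee2018, §3.2 proof of the Proposition
("Proposition 3 and Remark 1 of [Doucet–Pitt–Deligiannidis–Kohn 2015] show that for the IMH, `P̃` is a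
positive operator")] -/
theorem imh_jump_nonneg (hp : ∀ x, 0 < p x) (hq : ∀ x, 0 < q x) (u : X → ℝ) :
    0 ≤ ∑ x, ∑ y, p x * mhRate (fun _ z => q z) p x y * (u x * u y) := by
  have h := sum_sum_mul_min_nonneg (fun x => q x * u x) (fun x => p x / q x)
    (fun x => (div_pos (hp x) (hq x)).le)
  refine h.trans_eq (Finset.sum_congr rfl fun x _ => Finset.sum_congr rfl fun y _ => ?_)
  rw [imh_mul_mhRate_eq hp hq]
  ring

omit [DecidableEq X] in
/-- The per-state acceptance `ρ_x = Σ_y mhRate x y` (self-proposals included) satisfies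
`0 < ρ_x ≤ 1` and `ρ_x ≤ q_x/p_x = 1/w_x`. [cite: DeligiannidisLee2018, §3.1 Corollary
(cor:imh_rho_bounds) ("for the IMH, `1/(π(w) + w(x)) ≤ ϱ(x) ≤ 1 ∧ 1/w(x)`")] -/
theorem imh_accept_bounds (hp : ∀ x, 0 < p x) (hp1 : ∑ x, p x = 1) (hq : ∀ x, 0 < q x)
    (hq1 : ∑ x, q x = 1) (x : X) :
    0 < ∑ y, mhRate (fun _ z => q z) p x y ∧ ∑ y, mhRate (fun _ z => q z) p x y ≤ 1 ∧
      ∑ y, mhRate (fun _ z => q z) p x y ≤ q x / p x := by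
  have hrate : ∀ y, mhRate (fun _ z => q z) p x y = min (q y) (p y * q x / p x) := fun y => rfl
  refine ⟨?_, ?_, ?_⟩
  · have hxx : mhRate (fun _ z => q z) p x x = q x := by
      rw [hrate, mul_comm (p x) (q x), mul_div_assoc, div_self (hp x).ne', mul_one, min_self]
    have hnn : ∀ y ∈ (Finset.univ : Finset X), 0 ≤ mhRate (fun _ z => q z) p x y := fun y _ => by
      rw [hrate]
      exact le_min (hq y).le (div_nonneg (mul_pos (hp y) (hq x)).le (hp x).le)
    calc (0:ℝ) < q x := hq x
      _ = mhRate (fun _ z => q z) p x x := hxx.symm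
      _ ≤ ∑ y, mhRate (fun _ z => q z) p x y := Finset.single_le_sum hnn (Finset.mem_univ x)
  · calc ∑ y, mhRate (fun _ z => q z) p x y ≤ ∑ y, q y :=
          Finset.sum_le_sum fun y _ => by rw [hrate]; exact min_le_left _ _
      _ = 1 := hq1
  · calc ∑ y, mhRate (fun _ z => q z) p x y ≤ ∑ y, p y * q x / p x :=
          Finset.sum_le_sum fun y _ => by rw [hrate]; exact min_le_right _ _
      _ = q x / p x := by
          rw [← Finset.sum_div, ← Finset.sum_mul, hp1, one_mul]

omit [Fintype X] [DecidableEq X] in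
/-- Tangent line of the convex map `t ↦ 1/(a + t)` at `t = W`:
`1/(a + W) − (t − W)/(a + W)² ≤ 1/(a + t)` whenever `a + t > 0`, `a + W > 0`. [folklore] -/
private theorem inv_add_ge_tangent {a t W : ℝ} (ht : 0 < a + t) (hW : 0 < a + W) :
    1 / (a + W) - (t - W) / (a + W) ^ 2 ≤ 1 / (a + t) := by
  have key : 1 / (a + t) - (1 / (a + W) - (t - W) / (a + W) ^ 2)
      = (t - W) ^ 2 / ((a + t) * (a + W) ^ 2) := by
    field_simp
    ring
  have h0 : 0 ≤ (t - W) ^ 2 / ((a + t) * (a + W) ^ 2) := by positivity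
  linarith

omit [DecidableEq X] in
/-- **The lower acceptance bound `ρ_x ≥ 1/(π(w) + w_x)`** of the independence sampler, `w = p/q`
the importance weight and `π(w) = Σ_y p_y w_y = Σ_y p_y²/q_y` its target mean (the inverse Kish
fraction): pointwise `mhRate x y = q_y min(1, w_y/w_x) ≥ p_y/(w_x + w_y)`, then Jensen for the convex
`t ↦ 1/(w_x + t)` under `p`. [cite: DeligiannidisLee2018, §3.1 Corollary 2 (cor:imh_rho_bounds)
("for the IMH, `1/(π(w) + w(x)) ≤ ϱ(x) ≤ 1 ∧ 1/w(x)`"), from Lemma 1 (lem:gen_bounds_ap)] -/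
theorem imh_accept_ge_inv (hp : ∀ x, 0 < p x) (hp1 : ∑ x, p x = 1) (hq : ∀ x, 0 < q x) (x : X) :
    1 / (∑ y, p y * (p y / q y) + p x / q x) ≤ ∑ y, mhRate (fun _ z => q z) p x y := by
  have hrate : ∀ y, mhRate (fun _ z => q z) p x y = min (q y) (p y * q x / p x) := fun y => rfl
  set a := p x / q x with ha
  set W := ∑ y, p y * (p y / q y) with hW
  have ha0 : 0 < a := div_pos (hp x) (hq x)
  have hW0 : 0 ≤ W :=
    Finset.sum_nonneg fun y _ => mul_nonneg (hp y).le (div_pos (hp y) (hq y)).le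
  -- pointwise `mhRate x y ≥ p_y/(a + w_y)`
  have hpt : ∀ y, p y / (a + p y / q y) ≤ mhRate (fun _ z => q z) p x y := by
    intro y
    have hwy : 0 < p y / q y := div_pos (hp y) (hq y)
    rw [hrate]
    refine le_min ?_ ?_
    · rw [div_le_iff₀ (by linarith)]
      have e : q y * (p y / q y) = p y := mul_div_cancel₀ _ (hq y).ne'
      nlinarith [mul_pos (hq y) ha0, e]
    · have e : p y * q x / p x = p y / a := by
        rw [ha]
        field_simp
      rw [e]
      exact div_le_div_of_nonneg_left (hp y).le ha0 (by linarith)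
  -- Jensen by the tangent line at `W = Σ p w` (the linear term sums to zero)
  have hlin : ∑ y, p y * ((p y / q y - W) / (a + W) ^ 2) = 0 := by
    have e : ∑ y, p y * ((p y / q y - W) / (a + W) ^ 2)
        = (∑ y, (p y * (p y / q y) - p y * W)) / (a + W) ^ 2 := by
      rw [Finset.sum_div]
      exact Finset.sum_congr rfl fun y _ => by ring
    rw [e, Finset.sum_sub_distrib, ← Finset.sum_mul, hp1, one_mul, ← hW, sub_self, zero_div]
  have h1 : 1 / (a + W) ≤ ∑ y, p y / (a + p y / q y) := by
    calc 1 / (a + W) = ∑ y, p y * (1 / (a + W) - (p y / q y - W) / (a + W) ^ 2) := by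
          simp_rw [mul_sub]
          rw [Finset.sum_sub_distrib, hlin, sub_zero, ← Finset.sum_mul, hp1, one_mul]
      _ ≤ ∑ y, p y * (1 / (a + p y / q y)) := Finset.sum_le_sum fun y _ =>
          mul_le_mul_of_nonneg_left
            (inv_add_ge_tangent (by linarith [div_pos (hp y) (hq y)]) (by linarith)) (hp y).le
      _ = ∑ y, p y / (a + p y / q y) := Finset.sum_congr rfl fun y _ => by rw [mul_one_div]
  calc 1 / (W + a) = 1 / (a + W) := by rw [add_comm]
    _ ≤ ∑ y, p y / (a + p y / q y) := h1
    _ ≤ ∑ y, mhRate (fun _ z => q z) p x y := Finset.sum_le_sum fun y _ => hpt y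

/-- **`𝓔_A(u) ≤ Σ_x p_x ρ_x u_x²`** for the independence sampler `A = mhKernel (fun _ z => q z) p`
(`𝓔 = Σ p ρ u² −` the positive jump form). [cite: DeligiannidisLee2018, §3.2 proof of the Proposition] -/
theorem imh_dirichletForm_le (hp : ∀ x, 0 < p x) (hq : ∀ x, 0 < q x) (u : X → ℝ) :
    dirichletForm p (mhKernel (fun _ z => q z) p) u
      ≤ ∑ x, p x * (∑ y, mhRate (fun _ z => q z) p x y) * u x ^ 2 := by
  set R : X → X → ℝ := mhRate (fun _ z => q z) p with hR
  -- the diagonal of `mhKernel` is irrelevant: `(u x − u x)² = 0`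
  have e1 : dirichletForm p (mhKernel (fun _ z => q z) p) u
      = (1 / 2) * ∑ x, ∑ y, p x * R x y * (u x - u y) ^ 2 := by
    unfold dirichletForm
    congr 1
    refine Finset.sum_congr rfl fun x _ => Finset.sum_congr rfl fun y _ => ?_
    by_cases hxy : y = x
    · subst hxy; simp
    · rw [mhKernel_of_ne hxy]
  -- symmetry `p_x R x y = p_y R y x`
  have hsymm : ∀ x y, p x * R x y = p y * R y x := fun x y => by
    rw [hR, imh_mul_mhRate_eq hp hq, imh_mul_mhRate_eq hp hq, min_comm]; ring
  have e2 : ∑ x, ∑ y, p x * R x y * (u x - u y) ^ 2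
      = 2 * (∑ x, p x * (∑ y, R x y) * u x ^ 2) - 2 * ∑ x, ∑ y, p x * R x y * (u x * u y) := by
    have hA : ∑ x, ∑ y, p x * R x y * u y ^ 2 = ∑ x, ∑ y, p x * R x y * u x ^ 2 := by
      rw [Finset.sum_comm]
      exact Finset.sum_congr rfl fun x _ => Finset.sum_congr rfl fun y _ => by rw [hsymm]
    have hB : ∑ x, p x * (∑ y, R x y) * u x ^ 2 = ∑ x, ∑ y, p x * R x y * u x ^ 2 := by
      refine Finset.sum_congr rfl fun x _ => ?_
      rw [Finset.mul_sum, Finset.sum_mul]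
    have hsplit : ∑ x, ∑ y, p x * R x y * (u x - u y) ^ 2
        = ∑ x, ∑ y, p x * R x y * u x ^ 2 + ∑ x, ∑ y, p x * R x y * u y ^ 2
          - 2 * ∑ x, ∑ y, p x * R x y * (u x * u y) := by
      rw [Finset.mul_sum, ← Finset.sum_add_distrib, ← Finset.sum_sub_distrib]
      refine Finset.sum_congr rfl fun x _ => ?_
      rw [Finset.mul_sum, ← Finset.sum_add_distrib, ← Finset.sum_sub_distrib]
      exact Finset.sum_congr rfl fun y _ => by ring
    rw [hsplit, hA, hB]; ring
  rw [e1, e2]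
  have hJ := imh_jump_nonneg hp hq u
  linarith

/-- **THE INDEPENDENCE SAMPLER'S ASYMPTOTIC VARIANCE IS AT LEAST `2 Σ p f̄²/ρ − Σ p f̄²`** (the
acceptance-weighted floor; `f̄ = f − Σ p f`). [cite: DeligiannidisLee2018, §3.2 Proposition
(prop:imh_compare_snis), first inequality ("`2π(ϱ)π̃(f²/ϱ²) − π(f²) ≤ var(f, P)`")] -/
theorem imh_asympVar_ge_accept (hp : ∀ x, 0 < p x) (hp1 : ∑ x, p x = 1) (hq : ∀ x, 0 < q x)
    (hq1 : ∑ x, q x = 1) (f : X → ℝ) :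
    2 * (∑ x, p x * centred p f x ^ 2 / ∑ y, mhRate (fun _ z => q z) p x y)
        - ∑ x, p x * centred p f x ^ 2
      ≤ asympVar f p (mhKernel (fun _ z => q z) p) := by
  set A : Matrix X X ℝ := mhKernel (fun _ z => q z) p with hA
  set ρ : X → ℝ := fun x => ∑ y, mhRate (fun _ z => q z) p x y with hρ
  set g := centred p f with hg
  have hP : IsRowStochastic A := imh_isRowStochastic hp hq hq1
  have hDB : DetailedBalance p A := mhKernel_detailedBalance hp _
  have hst : IsStationary p A := hDB.isStationary hP.2
  have hK := isUnit_fundamentalInv hp1 hP hst (imh_isIrreducible hp hq hq1)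
  have hg0 : ∑ y, p y * g y = 0 := sum_mul_centred hp1 f
  have hρpos : ∀ x, 0 < ρ x := fun x => (imh_accept_bounds hp hp1 hq hq1 x).1
  -- variational inequality at `u = g/ρ`
  have hvar := variational_le hp hp1 hP hDB hK hg0 (fun x => g x / ρ x)
  have hE := imh_dirichletForm_le hp hq (fun x => g x / ρ x)
  have e1 : piInner p g (fun x => g x / ρ x) = ∑ x, p x * g x ^ 2 / ρ x := by
    unfold piInner
    exact Finset.sum_congr rfl fun x _ => by rw [sq]; ring
  have e2 : ∑ x, p x * ρ x * (g x / ρ x) ^ 2 = ∑ x, p x * g x ^ 2 / ρ x :=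
    Finset.sum_congr rfl fun x _ => by
      have hρx := (hρpos x).ne'
      field_simp
  rw [e1] at hvar
  rw [show (∑ x, p x * (∑ y, mhRate (fun _ z => q z) p x y) * (g x / ρ x) ^ 2)
      = ∑ x, p x * ρ x * (g x / ρ x) ^ 2 from rfl, e2] at hE
  rw [asympVar_eq_centred hp1 hP hst hK f, ← hg]
  have e3 : piInner p g g = ∑ x, p x * g x ^ 2 := by
    unfold piInner; exact Finset.sum_congr rfl fun x _ => by rw [sq]
  rw [e3]
  linarith

/-- **THE INDEPENDENCE SAMPLER NEVER BEATS SELF-NORMALISED IMPORTANCE SAMPLING**: for every `f`,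
`asympVar f p A ≥ Σ_x p_x w_x f̄_x²`, `w = p/q`, the limiting variance of `Σ w(Zᵢ) f(Zᵢ)/Σ w(Zᵢ)`
on i.i.d. draws `Zᵢ ∼ q` (`1/ρ ≥ max(1, w)` and `2 max(1, w) − 1 ≥ w`).
[cite: DeligiannidisLee2018, §3.2 Proposition ("and `var(f, P) ≥ π(w·f²)`"; "the former is always
larger than the latter")] -/
theorem imh_asympVar_ge_importanceSampling (hp : ∀ x, 0 < p x) (hp1 : ∑ x, p x = 1)
    (hq : ∀ x, 0 < q x) (hq1 : ∑ x, q x = 1) (f : X → ℝ) :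
    ∑ x, p x * (p x / q x) * centred p f x ^ 2 ≤ asympVar f p (mhKernel (fun _ z => q z) p) := by
  refine le_trans ?_ (imh_asympVar_ge_accept hp hp1 hq hq1 f)
  rw [Finset.mul_sum, ← Finset.sum_sub_distrib]
  refine Finset.sum_le_sum fun x _ => ?_
  obtain ⟨hρ0, hρ1, hρw⟩ := imh_accept_bounds hp hp1 hq hq1 x
  set ρx := ∑ y, mhRate (fun _ z => q z) p x y
  have hg2 : 0 ≤ p x * centred p f x ^ 2 := mul_nonneg (hp x).le (sq_nonneg _)
  -- `w ≤ 2/ρ − 1`: from `1/ρ ≥ w` and `1/ρ ≥ 1`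
  have h1 : p x / q x ≤ 1 / ρx := by
    rw [div_le_div_iff₀ (hq x) hρ0, one_mul]
    calc p x * ρx ≤ p x * (q x / p x) := mul_le_mul_of_nonneg_left hρw (hp x).le
      _ = q x := mul_div_cancel₀ _ (hp x).ne'
  have h2 : (1:ℝ) ≤ 1 / ρx := by rw [le_div_iff₀ hρ0, one_mul]; exact hρ1
  have h3 : p x / q x ≤ 2 * (1 / ρx) - 1 := by linarith
  calc p x * (p x / q x) * centred p f x ^ 2
      = (p x / q x) * (p x * centred p f x ^ 2) := by ring
    _ ≤ (2 * (1 / ρx) - 1) * (p x * centred p f x ^ 2) := mul_le_mul_of_nonneg_right h3 hg2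
    _ = 2 * (p x * centred p f x ^ 2 / ρx) - p x * centred p f x ^ 2 := by
        field_simp

/-- **The independence sampler never beats i.i.d. sampling from the target**:
`asympVar f p A ≥ Σ p f̄² = var_p(f)` (`ρ ≤ 1`; positivity of the sampler, cf. Liu 1996).
[cite: DeligiannidisLee2018, §3.2 Remark after the Proposition ("the first lower bound … is always
larger than `π(f²)`")] -/
theorem imh_asympVar_ge_var (hp : ∀ x, 0 < p x) (hp1 : ∑ x, p x = 1) (hq : ∀ x, 0 < q x)
    (hq1 : ∑ x, q x = 1) (f : X → ℝ) :
    ∑ x, p x * centred p f x ^ 2 ≤ asympVar f p (mhKernel (fun _ z => q z) p) := by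
  refine le_trans ?_ (imh_asympVar_ge_accept hp hp1 hq hq1 f)
  rw [Finset.mul_sum, ← Finset.sum_sub_distrib]
  refine Finset.sum_le_sum fun x _ => ?_
  obtain ⟨hρ0, hρ1, -⟩ := imh_accept_bounds hp hp1 hq hq1 x
  set ρx := ∑ y, mhRate (fun _ z => q z) p x y
  have hg2 : 0 ≤ p x * centred p f x ^ 2 := mul_nonneg (hp x).le (sq_nonneg _)
  have h2 : p x * centred p f x ^ 2 ≤ p x * centred p f x ^ 2 / ρx := by
    rw [le_div_iff₀ hρ0]
    exact mul_le_of_le_one_right hg2 hρ1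
  linarith

end Literature.Probability.MarkovChains

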